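import Summits.RiemannHypothesis.RiemannHypothesis.Theorems.WeilFormatCLogTailSums
import Literature.Analysis.Calculus.ConvexQuadrature
import HarnessLib

/-!
# Format C, design C∞: CONVEXITY (Hermite–Hadamard) brackets of the log tails `Σ_{j≥0} log^i(B₃+j)/(B₃+j)^{k+1}`

Route context: Fourier–Galerkin / Schur-complement certificates of Weil positivity on a window ("format C", design C∞;
cell memo `run/shared/lean/pub/rh-explicit/rh-explicit-weil-10/KERNEL-LEVER.md` §23 addendum 5; supporting
stmt-RiemannHypothesis-0098; seat rh-explicit-weil-10, for the (E2c) Hankel far tails of rh-explicit-weil-2).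
`WeilFormatCLogTailSums` brackets the log tails by the integral test, `F_k(B₃) ≤ Σ ≤ F_k(B₃−1)`
(`F_k(x) = (log x/k + 1/k²)/x^k`, relative width `≈ k/B₃`).  The summands `f(x) = log x/x^{k+1}` (and `log²x/x^{k+1}`)
are CONVEX beyond a small threshold, so the one-panel Hermite–Hadamard inequalities
(`Literature.Analysis.Calculus.convexOn_midpoint_le_integral`, `convexOn_integral_le_trapezoid`) bracket every term
between integrals over half-shifted and unshifted unit panels; telescoping gives

* generic: `convex_term_le_sub` (`f(c+j) ≤ P(c+j−½) − P(c+j+½)`, `P' = −f`), `sub_le_convex_terms`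
  (`P(c+j) − P(c+j+1) ≤ (f(c+j) + f(c+j+1))/2`), `tsum_le_of_convexOn_tail`, `le_tsum_of_convexOn_tail`
  (`P(c) + f(c)/2 ≤ Σ_{j≥0} f(c+j) ≤ P(c − ½)`);
* `convexOn_log_div_pow` — `log x/x^{k+1}` is convex on `[3, ∞)` (`k ≥ 1`; second derivative
  `((k+1)(k+2) log x − (2k+3))/x^{k+3} ≥ 0` once `log x ≥ 1`);
* `tsum_log_div_add_pow_le_half`, `half_le_tsum_log_div_add_pow` — for `4 ≤ B₃`:
  `F_k(B₃) + ½·log B₃/B₃^{k+1} ≤ Σ_{j≥0} log(B₃+j)/(B₃+j)^{k+1} ≤ F_k(B₃ − ½)` (relative width `≈ k(k+1)/(8B₃²)`,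
  `≈ 10⁻⁶` at `B₃ = 512`, `k = 1` — versus `2·10⁻³` for the integral test);
* `convexOn_logSq_div_pow` (`log²x/x^{k+1}` convex on `[15/2, ∞)`, i.e. once `log x ≥ 2`),
  `tsum_logSq_div_add_pow_le_half`, `half_le_tsum_logSq_div_add_pow` — for `8 ≤ B₃`:
  `G_k(B₃) + ½·log²B₃/B₃^{k+1} ≤ Σ_{j≥0} log²(B₃+j)/(B₃+j)^{k+1} ≤ G_k(B₃ − ½)`
  (`G_k(x) = (log²x/k + 2 log x/k² + 2/k³)/x^k`).

Elementary calculus; standard axioms; no definitions; no RH claim.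
-/

-- `Summit.RiemannHypothesis.RiemannHypothesis.…` is the layout-mandated namespace (summit = problem name).
set_option linter.dupNamespace false
set_option autoImplicit false

noncomputable section

open Real Filter Set MeasureTheory
open scoped Topology

namespace Summit.RiemannHypothesis.RiemannHypothesis.Theorems.WeilFormatC

open Literature.Analysis.Calculus (convexOn_midpoint_le_integral convexOn_integral_le_trapezoid)

/-! ## Generic Hermite–Hadamard brackets of a tail sum -/

/-- Midpoint panel: `f(c+j) ≤ P(c+j−½) − P(c+j+½)` for `f` convex and continuous on `[c−½, ∞)` with `P' = −f` there. -/
theorem convex_term_le_sub {f P : ℝ → ℝ} {c : ℝ} (hconv : ConvexOn ℝ (Ici (c - 1 / 2)) f)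
    (hcont : ContinuousOn f (Ici (c - 1 / 2))) (hP : ∀ x, c - 1 / 2 ≤ x → HasDerivAt P (-f x) x) (j : ℕ) :
    f (c + j) ≤ P (c + j - 1 / 2) - P (c + j + 1 / 2) := by
  have hj : (0 : ℝ) ≤ j := Nat.cast_nonneg j
  set a : ℝ := c + j - 1 / 2 with ha  -- the half-shifted unit panel around `c + j`
  set b : ℝ := c + j + 1 / 2 with hb
  have hab : a < b := by rw [ha, hb]; linarith
  have hsub : Icc a b ⊆ Ici (c - 1 / 2) := fun x hx ↦ by
    simp only [mem_Ici]; have := hx.1; rw [ha] at this; linarith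
  have hfi : IntervalIntegrable f volume a b :=
    (hcont.mono (by rw [uIcc_of_le hab.le]; exact hsub)).intervalIntegrable
  have hmid := convexOn_midpoint_le_integral hconv hab hsub hfi
  have e1 : b - a = 1 := by rw [ha, hb]; ring
  have e2 : (a + b) / 2 = c + j := by rw [ha, hb]; ring
  rw [e1, e2, one_mul] at hmid
  have hderiv : ∀ x ∈ uIcc a b, HasDerivAt (-P) (f x) x := by
    intro x hx
    rw [uIcc_of_le hab.le] at hx
    have h := (hP x (hsub hx)).neg
    simpa using h
  have hftc := intervalIntegral.integral_eq_sub_of_hasDerivAt hderiv hfi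
  rw [hftc] at hmid
  simp only [Pi.neg_apply] at hmid
  linarith

/-- Trapezoid panel: `P(c+j) − P(c+j+1) ≤ (f(c+j) + f(c+j+1))/2` for `f` convex and continuous on `[c, ∞)`, `P' = −f`. -/
theorem sub_le_convex_terms {f P : ℝ → ℝ} {c : ℝ} (hconv : ConvexOn ℝ (Ici c) f)
    (hcont : ContinuousOn f (Ici c)) (hP : ∀ x, c ≤ x → HasDerivAt P (-f x) x) (j : ℕ) :
    P (c + j) - P (c + j + 1) ≤ (f (c + j) + f (c + j + 1)) / 2 := by
  have hj : (0 : ℝ) ≤ j := Nat.cast_nonneg j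
  set a : ℝ := c + j with ha
  set b : ℝ := c + j + 1 with hb
  have hab : a < b := by rw [ha, hb]; linarith
  have hsub : Icc a b ⊆ Ici c := fun x hx ↦ by
    simp only [mem_Ici]; have := hx.1; rw [ha] at this; linarith
  have hfi : IntervalIntegrable f volume a b :=
    (hcont.mono (by rw [uIcc_of_le hab.le]; exact hsub)).intervalIntegrable
  have haI : a ∈ Ici c := by simp only [mem_Ici, ha]; linarith
  have hbI : b ∈ Ici c := by simp only [mem_Ici, hb]; linarith
  have htrap := convexOn_integral_le_trapezoid hconv haI hbI hab hfi
  have e1 : b - a = 1 := by rw [ha, hb]; ring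
  rw [e1, one_mul] at htrap
  have hderiv : ∀ x ∈ uIcc a b, HasDerivAt (-P) (f x) x := by
    intro x hx
    rw [uIcc_of_le hab.le] at hx
    have h := (hP x (hsub hx)).neg
    simpa using h
  have hftc := intervalIntegral.integral_eq_sub_of_hasDerivAt hderiv hfi
  rw [hftc] at htrap
  simp only [Pi.neg_apply] at htrap
  linarith

/-- **Upper convexity bracket of a tail**: `Σ_{j≥0} f(c+j) ≤ P(c − ½)` (with summability), for `f ≥ 0` convex continuous
on `[c−½, ∞)`, `P' = −f` there and `P ≥ 0` at the half-integers shifts. -/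
theorem tsum_le_of_convexOn_tail {f P : ℝ → ℝ} {c : ℝ} (hconv : ConvexOn ℝ (Ici (c - 1 / 2)) f)
    (hcont : ContinuousOn f (Ici (c - 1 / 2))) (hP : ∀ x, c - 1 / 2 ≤ x → HasDerivAt P (-f x) x)
    (hf0 : ∀ j : ℕ, 0 ≤ f (c + j)) (hP0 : ∀ j : ℕ, 0 ≤ P (c - 1 / 2 + j)) :
    Summable (fun j : ℕ ↦ f (c + j)) ∧ ∑' j : ℕ, f (c + j) ≤ P (c - 1 / 2) := by
  have htel : ∀ j : ℕ, f (c + j) ≤ P (c - 1 / 2 + j) - P (c - 1 / 2 + (j + 1 : ℕ)) := fun j ↦ by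
    push_cast
    rw [show c - 1 / 2 + j = c + j - 1 / 2 by ring, show c - 1 / 2 + (j + 1) = c + j + 1 / 2 by ring]
    exact convex_term_le_sub hconv hcont hP j
  have h := summable_and_tsum_le_of_telescope (P := fun j : ℕ ↦ P (c - 1 / 2 + j)) hf0 hP0 htel
  simpa using h

/-- **Lower convexity bracket of a tail**: `P(c) + f(c)/2 ≤ Σ_{j≥0} f(c+j)`, for `f` convex continuous on `[c, ∞)`,
`P' = −f` there, the series summable and `P(c+n) → 0`. -/
theorem le_tsum_of_convexOn_tail {f P : ℝ → ℝ} {c : ℝ} (hconv : ConvexOn ℝ (Ici c) f)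
    (hcont : ContinuousOn f (Ici c)) (hP : ∀ x, c ≤ x → HasDerivAt P (-f x) x)
    (hs : Summable (fun j : ℕ ↦ f (c + j))) (hP0 : Tendsto (fun n : ℕ ↦ P (c + n)) atTop (𝓝 0)) :
    P c + f c / 2 ≤ ∑' j : ℕ, f (c + j) := by
  have hf0 : Tendsto (fun n : ℕ ↦ f (c + n)) atTop (𝓝 0) := hs.tendsto_atTop_zero
  have hR0 : Tendsto (fun n : ℕ ↦ P (c + n) + f (c + n) / 2) atTop (𝓝 0) := by
    have := hP0.add (hf0.div_const 2)
    simpa using this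
  have htel : ∀ j : ℕ, (P (c + j) + f (c + j) / 2) - (P (c + (j + 1 : ℕ)) + f (c + (j + 1 : ℕ)) / 2) ≤ f (c + j) := by
    intro j
    have h := sub_le_convex_terms hconv hcont hP j
    push_cast; rw [show c + (j + 1) = c + j + 1 by ring]; linarith
  have h := le_tsum_of_telescope (P := fun j : ℕ ↦ P (c + j) + f (c + j) / 2) hs hR0 htel
  simpa using h

/-! ## Convexity of `log x / x^{k+1}` on `[3, ∞)` -/

/-- First derivative of `log x/x^{k+1}`: `(1 − (k+1) log x)/x^{k+2}` (`x > 0`). -/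
theorem hasDerivAt_log_div_pow (k : ℕ) {x : ℝ} (hx : 0 < x) :
    HasDerivAt (fun y : ℝ ↦ Real.log y / y ^ (k + 1)) ((1 - (k + 1 : ℝ) * Real.log x) / x ^ (k + 2)) x := by
  have h1 := Real.hasDerivAt_log hx.ne'
  have h2 := hasDerivAt_pow (k + 1) x
  have h := h1.div h2 (pow_ne_zero _ hx.ne')
  have hx' : x ≠ 0 := hx.ne'
  have e : (x⁻¹ * x ^ (k + 1) - Real.log x * (((k + 1 : ℕ) : ℝ) * x ^ (k + 1 - 1))) / (x ^ (k + 1)) ^ 2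
      = (1 - (k + 1 : ℝ) * Real.log x) / x ^ (k + 2) := by
    rw [Nat.add_sub_cancel, div_eq_div_iff (pow_ne_zero _ (pow_ne_zero _ hx')) (pow_ne_zero _ hx')]
    push_cast
    field_simp
    ring
  rw [e] at h
  exact h

/-- Second derivative: `d/dx (1 − (k+1) log x)/x^{k+2} = ((k+1)(k+2) log x − (2k+3))/x^{k+3}` (`x > 0`). -/
theorem hasDerivAt_log_div_pow_deriv (k : ℕ) {x : ℝ} (hx : 0 < x) :
    HasDerivAt (fun y : ℝ ↦ (1 - (k + 1 : ℝ) * Real.log y) / y ^ (k + 2))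
      ((((k : ℝ) + 1) * (k + 2) * Real.log x - (2 * k + 3)) / x ^ (k + 3)) x := by
  have h1 : HasDerivAt (fun y : ℝ ↦ 1 - (k + 1 : ℝ) * Real.log y) (-((k + 1 : ℝ) * x⁻¹)) x := by
    have := ((Real.hasDerivAt_log hx.ne').const_mul (k + 1 : ℝ)).const_sub 1
    simpa using this
  have h2 := hasDerivAt_pow (k + 2) x
  have h := h1.div h2 (pow_ne_zero _ hx.ne')
  have hx' : x ≠ 0 := hx.ne'
  have e : (-((k + 1 : ℝ) * x⁻¹) * x ^ (k + 2) - (1 - (k + 1 : ℝ) * Real.log x) * (((k + 2 : ℕ) : ℝ) * x ^ (k + 2 - 1)))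
        / (x ^ (k + 2)) ^ 2 = ((((k : ℝ) + 1) * (k + 2) * Real.log x - (2 * k + 3)) / x ^ (k + 3)) := by
    rw [show k + 2 - 1 = k + 1 by omega, div_eq_div_iff (pow_ne_zero _ (pow_ne_zero _ hx')) (pow_ne_zero _ hx')]
    push_cast
    field_simp
    ring
  rw [e] at h
  exact h

/-- **`log x / x^{k+1}` is convex on `[3, ∞)`** (`1 ≤ k`). -/
theorem convexOn_log_div_pow {k : ℕ} (hk : 1 ≤ k) :
    ConvexOn ℝ (Ici (3 : ℝ)) (fun x : ℝ ↦ Real.log x / x ^ (k + 1)) := by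
  have hpos : ∀ x ∈ Ici (3 : ℝ), (0 : ℝ) < x := fun x hx ↦ by simp only [mem_Ici] at hx; linarith
  have hint : interior (Ici (3 : ℝ)) = Ioi 3 := interior_Ici
  have hposI : ∀ x ∈ Ioi (3 : ℝ), (0 : ℝ) < x := fun x hx ↦ by simp only [mem_Ioi] at hx; linarith
  -- `deriv f = f₁` on `Ioi 0`
  have hd1 : ∀ x : ℝ, 0 < x → deriv (fun y : ℝ ↦ Real.log y / y ^ (k + 1)) x
      = (1 - (k + 1 : ℝ) * Real.log x) / x ^ (k + 2) := fun x hx ↦ (hasDerivAt_log_div_pow k hx).deriv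
  have hd1ev : ∀ x : ℝ, 0 < x → deriv (fun y : ℝ ↦ Real.log y / y ^ (k + 1))
      =ᶠ[𝓝 x] fun y ↦ (1 - (k + 1 : ℝ) * Real.log y) / y ^ (k + 2) := by
    intro x hx
    filter_upwards [Ioi_mem_nhds hx] with y hy using hd1 y hy
  have hd2 : ∀ x : ℝ, 0 < x → HasDerivAt (deriv (fun y : ℝ ↦ Real.log y / y ^ (k + 1)))
      ((((k : ℝ) + 1) * (k + 2) * Real.log x - (2 * k + 3)) / x ^ (k + 3)) x :=
    fun x hx ↦ (hasDerivAt_log_div_pow_deriv k hx).congr_of_eventuallyEq (hd1ev x hx)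
  refine convexOn_of_deriv2_nonneg (convex_Ici 3) ?_ ?_ ?_ ?_
  · exact fun x hx ↦ (hasDerivAt_log_div_pow k (hpos x hx)).continuousAt.continuousWithinAt
  · rw [hint]; exact fun x hx ↦ (hasDerivAt_log_div_pow k (hposI x hx)).differentiableAt.differentiableWithinAt
  · rw [hint]; exact fun x hx ↦ (hd2 x (hposI x hx)).differentiableAt.differentiableWithinAt
  · rw [hint]
    intro x hx
    have hx0 := hposI x hx
    have hx3 : (3 : ℝ) ≤ x := le_of_lt hx
    rw [Function.iterate_succ, Function.iterate_one, Function.comp_apply, (hd2 x hx0).deriv]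
    apply div_nonneg _ (by positivity)
    have hlog3 : (1 : ℝ) ≤ Real.log 3 := by
      rw [Real.le_log_iff_exp_le (by norm_num)]; have := Real.exp_one_lt_d9; linarith
    have hlog : (1 : ℝ) ≤ Real.log x := hlog3.trans (Real.log_le_log (by norm_num) hx3)
    have hk1 : (1 : ℝ) ≤ k := by exact_mod_cast hk
    have h1 : ((k : ℝ) + 1) * (k + 2) * 1 ≤ ((k : ℝ) + 1) * (k + 2) * Real.log x :=
      mul_le_mul_of_nonneg_left hlog (by positivity)
    have h2 : (1 : ℝ) ≤ (k : ℝ) * k := by nlinarith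
    nlinarith [h1, h2]

/-! ## The sharpened log-tail brackets -/

/-- **Upper convexity bracket**: for `1 ≤ k`, `4 ≤ B₃`,
`Σ_{j≥0} log(B₃+j)/(B₃+j)^{k+1} ≤ F_k(B₃ − ½) = (log(B₃−½)/k + 1/k²)/(B₃−½)^k`. -/
theorem tsum_log_div_add_pow_le_half {k : ℕ} (hk : 1 ≤ k) {B₃ : ℕ} (hB₃ : 4 ≤ B₃) :
    ∑' j : ℕ, Real.log ((B₃ : ℝ) + j) / ((B₃ : ℝ) + j) ^ (k + 1)
      ≤ (Real.log ((B₃ : ℝ) - 1 / 2) / k + 1 / (k : ℝ) ^ 2) / ((B₃ : ℝ) - 1 / 2) ^ k := by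
  have hB : (4 : ℝ) ≤ B₃ := by exact_mod_cast hB₃
  have hsub : Ici ((B₃ : ℝ) - 1 / 2) ⊆ Ici (3 : ℝ) := fun x hx ↦ by
    simp only [mem_Ici] at hx ⊢; linarith
  have hconv := (convexOn_log_div_pow hk).subset hsub (convex_Ici _)
  have hcont : ContinuousOn (fun x : ℝ ↦ Real.log x / x ^ (k + 1)) (Ici ((B₃ : ℝ) - 1 / 2)) := fun x hx ↦
    (hasDerivAt_log_div_pow k (by simp only [mem_Ici] at hx; linarith)).continuousAt.continuousWithinAt
  have hP : ∀ x, (B₃ : ℝ) - 1 / 2 ≤ x →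
      HasDerivAt (fun y : ℝ ↦ (Real.log y / k + 1 / (k : ℝ) ^ 2) / y ^ k) (-(Real.log x / x ^ (k + 1))) x :=
    fun x hx ↦ hasDerivAt_logTailPrim hk (by linarith)
  have hf0 : ∀ j : ℕ, 0 ≤ Real.log ((B₃ : ℝ) + j) / ((B₃ : ℝ) + j) ^ (k + 1) := fun j ↦ by
    have : (1 : ℝ) ≤ (B₃ : ℝ) + j := by linarith [(Nat.cast_nonneg j : (0:ℝ) ≤ j)]
    exact div_nonneg (Real.log_nonneg this) (by positivity)
  have hP0 : ∀ j : ℕ, 0 ≤ (Real.log ((B₃ : ℝ) - 1 / 2 + j) / k + 1 / (k : ℝ) ^ 2) / ((B₃ : ℝ) - 1 / 2 + j) ^ k :=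
    fun j ↦ by
    have : (1 : ℝ) ≤ (B₃ : ℝ) - 1 / 2 + j := by linarith [(Nat.cast_nonneg j : (0:ℝ) ≤ j)]
    have := Real.log_nonneg this
    positivity
  exact (tsum_le_of_convexOn_tail hconv hcont hP hf0 hP0).2

/-- **Lower convexity bracket**: for `1 ≤ k`, `4 ≤ B₃`,
`F_k(B₃) + ½·log B₃/B₃^{k+1} ≤ Σ_{j≥0} log(B₃+j)/(B₃+j)^{k+1}`. -/
theorem half_le_tsum_log_div_add_pow {k : ℕ} (hk : 1 ≤ k) {B₃ : ℕ} (hB₃ : 4 ≤ B₃) :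
    (Real.log (B₃ : ℝ) / k + 1 / (k : ℝ) ^ 2) / (B₃ : ℝ) ^ k + Real.log (B₃ : ℝ) / (B₃ : ℝ) ^ (k + 1) / 2
      ≤ ∑' j : ℕ, Real.log ((B₃ : ℝ) + j) / ((B₃ : ℝ) + j) ^ (k + 1) := by
  have hB : (4 : ℝ) ≤ B₃ := by exact_mod_cast hB₃
  have hsub : Ici (B₃ : ℝ) ⊆ Ici (3 : ℝ) := fun x hx ↦ by
    simp only [mem_Ici] at hx ⊢; linarith
  have hconv := (convexOn_log_div_pow hk).subset hsub (convex_Ici _)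
  have hcont : ContinuousOn (fun x : ℝ ↦ Real.log x / x ^ (k + 1)) (Ici (B₃ : ℝ)) :=
    fun x hx ↦ (hasDerivAt_log_div_pow k (by simp only [mem_Ici] at hx; linarith)).continuousAt.continuousWithinAt
  have hP : ∀ x, (B₃ : ℝ) ≤ x →
      HasDerivAt (fun y : ℝ ↦ (Real.log y / k + 1 / (k : ℝ) ^ 2) / y ^ k) (-(Real.log x / x ^ (k + 1))) x :=
    fun x hx ↦ hasDerivAt_logTailPrim hk (by linarith)
  have hs := (summable_log_div_add_pow hk (by omega : 3 ≤ B₃)).1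
  have hP0 := tendsto_logTailPrim_add hk B₃
  have h := le_tsum_of_convexOn_tail hconv hcont hP hs hP0
  simpa using h

/-! ## Convexity of `log² x / x^{k+1}` on `[15/2, ∞)` and the sharpened log² brackets -/

/-- `2 ≤ log (15/2)`. -/
theorem two_le_log_fifteen_halves : (2 : ℝ) ≤ Real.log (15 / 2) := by
  rw [Real.le_log_iff_exp_le (by norm_num)]
  have h1 := Real.exp_one_lt_d9
  have h0 := Real.exp_pos 1
  have e : Real.exp 2 = Real.exp 1 * Real.exp 1 := by rw [← Real.exp_add]; norm_num
  rw [e]; nlinarith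

/-- First derivative of `log²x/x^{k+1}`: `(2 log x − (k+1) log²x)/x^{k+2}` (`x > 0`). -/
theorem hasDerivAt_logSq_div_pow (k : ℕ) {x : ℝ} (hx : 0 < x) :
    HasDerivAt (fun y : ℝ ↦ Real.log y ^ 2 / y ^ (k + 1))
      ((2 * Real.log x - (k + 1 : ℝ) * Real.log x ^ 2) / x ^ (k + 2)) x := by
  have hl := Real.hasDerivAt_log hx.ne'
  have h1 : HasDerivAt (fun y : ℝ ↦ Real.log y ^ 2) ((2 : ℕ) * Real.log x ^ (2 - 1) * x⁻¹) x := hl.pow 2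
  have h2 := hasDerivAt_pow (k + 1) x
  have h := h1.div h2 (pow_ne_zero _ hx.ne')
  have hx' : x ≠ 0 := hx.ne'
  have e : ((2 : ℕ) * Real.log x ^ (2 - 1) * x⁻¹ * x ^ (k + 1)
        - Real.log x ^ 2 * (((k + 1 : ℕ) : ℝ) * x ^ (k + 1 - 1))) / (x ^ (k + 1)) ^ 2
      = (2 * Real.log x - (k + 1 : ℝ) * Real.log x ^ 2) / x ^ (k + 2) := by
    rw [Nat.add_sub_cancel, show (2 : ℕ) - 1 = 1 by norm_num, pow_one,
      div_eq_div_iff (pow_ne_zero _ (pow_ne_zero _ hx')) (pow_ne_zero _ hx')]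
    push_cast
    field_simp
    ring
  rw [e] at h
  exact h

/-- Second derivative: `d/dx (2 log x − (k+1) log²x)/x^{k+2} = (2 − 2(2k+3) log x + (k+1)(k+2) log²x)/x^{k+3}`. -/
theorem hasDerivAt_logSq_div_pow_deriv (k : ℕ) {x : ℝ} (hx : 0 < x) :
    HasDerivAt (fun y : ℝ ↦ (2 * Real.log y - (k + 1 : ℝ) * Real.log y ^ 2) / y ^ (k + 2))
      ((2 - 2 * (2 * k + 3 : ℝ) * Real.log x + ((k : ℝ) + 1) * (k + 2) * Real.log x ^ 2) / x ^ (k + 3)) x := by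
  have hl := Real.hasDerivAt_log hx.ne'
  have h1 : HasDerivAt (fun y : ℝ ↦ 2 * Real.log y - (k + 1 : ℝ) * Real.log y ^ 2)
      (2 * x⁻¹ - (k + 1 : ℝ) * ((2 : ℕ) * Real.log x ^ (2 - 1) * x⁻¹)) x :=
    (hl.const_mul 2).sub ((hl.pow 2).const_mul (k + 1 : ℝ))
  have h2 := hasDerivAt_pow (k + 2) x
  have h := h1.div h2 (pow_ne_zero _ hx.ne')
  have hx' : x ≠ 0 := hx.ne'
  have e : ((2 * x⁻¹ - (k + 1 : ℝ) * ((2 : ℕ) * Real.log x ^ (2 - 1) * x⁻¹)) * x ^ (k + 2)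
        - (2 * Real.log x - (k + 1 : ℝ) * Real.log x ^ 2) * (((k + 2 : ℕ) : ℝ) * x ^ (k + 2 - 1))) / (x ^ (k + 2)) ^ 2
      = (2 - 2 * (2 * k + 3 : ℝ) * Real.log x + ((k : ℝ) + 1) * (k + 2) * Real.log x ^ 2) / x ^ (k + 3) := by
    rw [show k + 2 - 1 = k + 1 by omega, show (2 : ℕ) - 1 = 1 by norm_num, pow_one,
      div_eq_div_iff (pow_ne_zero _ (pow_ne_zero _ hx')) (pow_ne_zero _ hx')]
    push_cast
    field_simp
    ring
  rw [e] at h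
  exact h

/-- **`log² x / x^{k+1}` is convex on `[15/2, ∞)`** (`1 ≤ k`; second derivative `≥ 0` once `log x ≥ 2`). -/
theorem convexOn_logSq_div_pow {k : ℕ} (hk : 1 ≤ k) :
    ConvexOn ℝ (Ici (15 / 2 : ℝ)) (fun x : ℝ ↦ Real.log x ^ 2 / x ^ (k + 1)) := by
  have hpos : ∀ x ∈ Ici (15 / 2 : ℝ), (0 : ℝ) < x := fun x hx ↦ by simp only [mem_Ici] at hx; linarith
  have hint : interior (Ici (15 / 2 : ℝ)) = Ioi (15 / 2) := interior_Ici
  have hposI : ∀ x ∈ Ioi (15 / 2 : ℝ), (0 : ℝ) < x := fun x hx ↦ by simp only [mem_Ioi] at hx; linarith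
  have hd1 : ∀ x : ℝ, 0 < x → deriv (fun y : ℝ ↦ Real.log y ^ 2 / y ^ (k + 1)) x
      = (2 * Real.log x - (k + 1 : ℝ) * Real.log x ^ 2) / x ^ (k + 2) :=
    fun x hx ↦ (hasDerivAt_logSq_div_pow k hx).deriv
  have hd1ev : ∀ x : ℝ, 0 < x → deriv (fun y : ℝ ↦ Real.log y ^ 2 / y ^ (k + 1))
      =ᶠ[𝓝 x] fun y ↦ (2 * Real.log y - (k + 1 : ℝ) * Real.log y ^ 2) / y ^ (k + 2) := by
    intro x hx
    filter_upwards [Ioi_mem_nhds hx] with y hy using hd1 y hy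
  have hd2 : ∀ x : ℝ, 0 < x → HasDerivAt (deriv (fun y : ℝ ↦ Real.log y ^ 2 / y ^ (k + 1)))
      ((2 - 2 * (2 * k + 3 : ℝ) * Real.log x + ((k : ℝ) + 1) * (k + 2) * Real.log x ^ 2) / x ^ (k + 3)) x :=
    fun x hx ↦ (hasDerivAt_logSq_div_pow_deriv k hx).congr_of_eventuallyEq (hd1ev x hx)
  refine convexOn_of_deriv2_nonneg (convex_Ici _) ?_ ?_ ?_ ?_
  · exact fun x hx ↦ (hasDerivAt_logSq_div_pow k (hpos x hx)).continuousAt.continuousWithinAt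
  · rw [hint]; exact fun x hx ↦ (hasDerivAt_logSq_div_pow k (hposI x hx)).differentiableAt.differentiableWithinAt
  · rw [hint]; exact fun x hx ↦ (hd2 x (hposI x hx)).differentiableAt.differentiableWithinAt
  · rw [hint]
    intro x hx
    have hx0 := hposI x hx
    have hx3 : (15 / 2 : ℝ) ≤ x := le_of_lt hx
    rw [Function.iterate_succ, Function.iterate_one, Function.comp_apply, (hd2 x hx0).deriv]
    apply div_nonneg _ (by positivity)
    have hlog : (2 : ℝ) ≤ Real.log x :=
      two_le_log_fifteen_halves.trans (Real.log_le_log (by norm_num) hx3)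
    have hk1 : (1 : ℝ) ≤ k := by exact_mod_cast hk
    have hq : 2 - 2 * (2 * k + 3 : ℝ) * Real.log x + ((k : ℝ) + 1) * (k + 2) * Real.log x ^ 2
        = ((k : ℝ) + 1) * (k + 2) * (Real.log x - 2) ^ 2
          + (4 * ((k : ℝ) + 1) * (k + 2) - 2 * (2 * k + 3)) * (Real.log x - 2) + (4 * (k : ℝ) ^ 2 + 4 * k - 2) := by
      ring
    rw [hq]
    have hL : 0 ≤ Real.log x - 2 := by linarith
    have hA : (0 : ℝ) ≤ ((k : ℝ) + 1) * (k + 2) * (Real.log x - 2) ^ 2 := by positivity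
    have hB : (0 : ℝ) ≤ (4 * ((k : ℝ) + 1) * (k + 2) - 2 * (2 * k + 3)) * (Real.log x - 2) :=
      mul_nonneg (by nlinarith) hL
    have hC : (0 : ℝ) ≤ 4 * (k : ℝ) ^ 2 + 4 * k - 2 := by nlinarith
    linarith

/-- **Upper convexity bracket (log²)**: for `1 ≤ k`, `8 ≤ B₃`,
`Σ_{j≥0} log²(B₃+j)/(B₃+j)^{k+1} ≤ G_k(B₃ − ½)`. -/
theorem tsum_logSq_div_add_pow_le_half {k : ℕ} (hk : 1 ≤ k) {B₃ : ℕ} (hB₃ : 8 ≤ B₃) :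
    ∑' j : ℕ, Real.log ((B₃ : ℝ) + j) ^ 2 / ((B₃ : ℝ) + j) ^ (k + 1)
      ≤ (Real.log ((B₃ : ℝ) - 1 / 2) ^ 2 / k + 2 * Real.log ((B₃ : ℝ) - 1 / 2) / (k : ℝ) ^ 2 + 2 / (k : ℝ) ^ 3)
          / ((B₃ : ℝ) - 1 / 2) ^ k := by
  have hB : (8 : ℝ) ≤ B₃ := by exact_mod_cast hB₃
  have hsub : Ici ((B₃ : ℝ) - 1 / 2) ⊆ Ici (15 / 2 : ℝ) := fun x hx ↦ by
    simp only [mem_Ici] at hx ⊢; linarith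
  have hconv := (convexOn_logSq_div_pow hk).subset hsub (convex_Ici _)
  have hcont : ContinuousOn (fun x : ℝ ↦ Real.log x ^ 2 / x ^ (k + 1)) (Ici ((B₃ : ℝ) - 1 / 2)) :=
    fun x hx ↦ (hasDerivAt_logSq_div_pow k
      (by simp only [mem_Ici] at hx; linarith)).continuousAt.continuousWithinAt
  have hP : ∀ x, (B₃ : ℝ) - 1 / 2 ≤ x →
      HasDerivAt (fun y : ℝ ↦ (Real.log y ^ 2 / k + 2 * Real.log y / (k : ℝ) ^ 2 + 2 / (k : ℝ) ^ 3) / y ^ k)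
        (-(Real.log x ^ 2 / x ^ (k + 1))) x :=
    fun x hx ↦ hasDerivAt_logSqTailPrim hk (by linarith)
  have hf0 : ∀ j : ℕ, 0 ≤ Real.log ((B₃ : ℝ) + j) ^ 2 / ((B₃ : ℝ) + j) ^ (k + 1) := fun j ↦ by
    have : (0 : ℝ) ≤ (B₃ : ℝ) + j := by linarith [(Nat.cast_nonneg j : (0:ℝ) ≤ j)]
    positivity
  have hP0 : ∀ j : ℕ, 0 ≤ (Real.log ((B₃ : ℝ) - 1 / 2 + j) ^ 2 / k + 2 * Real.log ((B₃ : ℝ) - 1 / 2 + j) / (k : ℝ) ^ 2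
      + 2 / (k : ℝ) ^ 3) / ((B₃ : ℝ) - 1 / 2 + j) ^ k := fun j ↦ by
    have h1 : (1 : ℝ) ≤ (B₃ : ℝ) - 1 / 2 + j := by linarith [(Nat.cast_nonneg j : (0:ℝ) ≤ j)]
    have := Real.log_nonneg h1
    positivity
  exact (tsum_le_of_convexOn_tail hconv hcont hP hf0 hP0).2

/-- **Lower convexity bracket (log²)**: for `1 ≤ k`, `8 ≤ B₃`,
`G_k(B₃) + ½·log²B₃/B₃^{k+1} ≤ Σ_{j≥0} log²(B₃+j)/(B₃+j)^{k+1}`. -/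
theorem half_le_tsum_logSq_div_add_pow {k : ℕ} (hk : 1 ≤ k) {B₃ : ℕ} (hB₃ : 8 ≤ B₃) :
    (Real.log (B₃ : ℝ) ^ 2 / k + 2 * Real.log (B₃ : ℝ) / (k : ℝ) ^ 2 + 2 / (k : ℝ) ^ 3) / (B₃ : ℝ) ^ k
        + Real.log (B₃ : ℝ) ^ 2 / (B₃ : ℝ) ^ (k + 1) / 2
      ≤ ∑' j : ℕ, Real.log ((B₃ : ℝ) + j) ^ 2 / ((B₃ : ℝ) + j) ^ (k + 1) := by
  have hB : (8 : ℝ) ≤ B₃ := by exact_mod_cast hB₃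
  have hsub : Ici (B₃ : ℝ) ⊆ Ici (15 / 2 : ℝ) := fun x hx ↦ by
    simp only [mem_Ici] at hx ⊢; linarith
  have hconv := (convexOn_logSq_div_pow hk).subset hsub (convex_Ici _)
  have hcont : ContinuousOn (fun x : ℝ ↦ Real.log x ^ 2 / x ^ (k + 1)) (Ici (B₃ : ℝ)) :=
    fun x hx ↦ (hasDerivAt_logSq_div_pow k
      (by simp only [mem_Ici] at hx; linarith)).continuousAt.continuousWithinAt
  have hP : ∀ x, (B₃ : ℝ) ≤ x →
      HasDerivAt (fun y : ℝ ↦ (Real.log y ^ 2 / k + 2 * Real.log y / (k : ℝ) ^ 2 + 2 / (k : ℝ) ^ 3) / y ^ k)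
        (-(Real.log x ^ 2 / x ^ (k + 1))) x :=
    fun x hx ↦ hasDerivAt_logSqTailPrim hk (by linarith)
  have hs := (summable_logSq_div_add_pow hk (by omega : 4 ≤ B₃)).1
  have hP0 := tendsto_logSqTailPrim_add hk B₃
  have h := le_tsum_of_convexOn_tail hconv hcont hP hs hP0
  simpa using h

end Summit.RiemannHypothesis.RiemannHypothesis.Theorems.WeilFormatC

end
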